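/-
Origin: SANITY lane `planner-pub-hodgecm-mc-sanity-1-g5-0` (unit pub-hodgecm-mc-sanity-1-g5, gen 5 of mc-sanity-1,
node SAN-13 = the ORIENTATION PIN for the `hol` junction (model1-g4 02:58:27Z (ASM), model2-g4 (YY′) 03:00:04Z)),
2026-08-19.  TREE-side leaf over mc-autform-2-g5's LANDED `ShimuraVarieties/UnitaryBallCauchyRiemann.lean` (p182968, commit
244059638e94, tree md5 c1445169d806: `pMat`); proposed by mc-autform-2-g5 on my behalf (STATUS 03:20:12Z / 03:27:17Z), bytes mine.
KERNEL only, [folklore] throughout, nothing cited, no records / Prop-valued defs / facts.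
PACKAGE CROSS-REFERENCE (other ball copy `HodgeCM.PerL34.BallModel`, not importable here — vendored vs tree module names):
pv02-g3's `HodgeCM/PerL34/BallCRKType.lean` has the same literals `BallCR.Xplus v` (= `pPlus v`), `BallCR.Xlow w`
(`pMinus b = Xlow (star b)`), `Xp_add_I_Xp : Xp v + I • Xp (I • v) = 2 • Xlow (star v)`, `Xp_sub_I_Xp`, and
`HodgeCM/PerL34/BallCR.lean` proves `killed_iff_hol` for `𝔭₋ = range (v ↦ R(X_v) + i·R(X_{iv}))` — the same orientation.
-/
import Literature.AlgebraicGeometry.ShimuraVarieties.UnitaryBallCauchyRiemann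

/-!
# The `𝔭 = 𝔭₊ ⊕ 𝔭₋` split of autform-2's exponential chart, and which half is `𝔭₋`

autform-2's chart is `b ↦ exp X_b`, `X_b = pMat b = [[0, b], [bᴴ, 0]]`, with `b ↦ exp X_b • x₀` having derivative
THE IDENTITY of `ℂ²` at `0` (`hasFDerivAt_expOrbit`), so "holomorphic on the ball near `x₀`" is "ℂ-differentiable
in `b`".  Inside `M₃(ℂ) = 𝔲(2,1) ⊕ i𝔲(2,1) = 𝔤_ℂ` the real-linear `b ↦ X_b` splits UNIQUELY as

  `pMat b = pPlus b + pMinus b`,  `pPlus b = [[0, b], [0, 0]]` ℂ-LINEAR in `b`,  `pMinus b = [[0, 0], [bᴴ, 0]]`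
  CONJUGATE-linear in `b`, `(pPlus b)ᴴ = pMinus b`, both halves abelian and square-zero.

ORIENTATION PIN (kernel, `isLinear_comp_pMat_iff`): for any `ℂ`-linear `φ` on `𝔤_ℂ` (the complexified
differential of a group function at a point), `b ↦ φ (X_b)` is `ℂ`-linear — autform-2's Cauchy–Riemann condition
`X_{ib} f = i · X_b f` — IFF `φ ∘ pMinus = 0`.  Hence, in these coordinates,

  **`𝔭₋ = range pMinus` = the LOWER-LEFT block `{[[0, 0], [c, 0]]}`**, `𝔭₊ = range pPlus` = the upper-right block,

and the (REP) half of `hol` must show that `ω_∞` (complexified) of the LOWER-LEFT block kills the printed vectors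
`φ⁰`; if a Fock convention makes the lower-left block act by creation operators on `φ⁰`, `hol` is false as typed.
The degenerate side cannot see this (mc-sanity-1-g5 `Sanity/ZeroSchwartzIndex` § 6 `hol_degS`: over an
archimedean-trivial side every restricted theta form is `0`).
-/

set_option autoImplicit false

noncomputable section

open scoped Matrix ComplexConjugate

namespace Literature.AlgebraicGeometry.ShimuraVarieties

namespace BallForms

/-- `𝔭₊`-component of `X_b`: the upper-right block `[[0, b], [0, 0]]`. [folklore] -/
def pPlus (b : Fin 2 → ℂ) : Matrix (Fin 3) (Fin 3) ℂ := Matrix.of ![![0, 0, b 0], ![0, 0, b 1], ![0, 0, 0]]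

/-- `𝔭₋`-component of `X_b`: the lower-left block `[[0, 0], [bᴴ, 0]]`. [folklore] -/
def pMinus (b : Fin 2 → ℂ) : Matrix (Fin 3) (Fin 3) ℂ :=
  Matrix.of ![![0, 0, 0], ![0, 0, 0], ![conj (b 0), conj (b 1), 0]]

/-- `X_b = X_b⁺ + X_b⁻`. [folklore] -/
theorem pMat_eq_pPlus_add_pMinus (b : Fin 2 → ℂ) : pMat b = pPlus b + pMinus b := by
  ext i j; fin_cases i <;> fin_cases j <;> simp [pMat, pPlus, pMinus]

/-- `(X_b⁺)ᴴ = X_b⁻`. [folklore] -/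
theorem conjTranspose_pPlus (b : Fin 2 → ℂ) : (pPlus b)ᴴ = pMinus b := by
  ext i j; fin_cases i <;> fin_cases j <;> simp [pPlus, pMinus, Matrix.conjTranspose_apply]

/-- `b ↦ X_b⁺` is `ℂ`-LINEAR. [folklore] -/
def pPlusₗ : (Fin 2 → ℂ) →ₗ[ℂ] Matrix (Fin 3) (Fin 3) ℂ where
  toFun := pPlus
  map_add' b b' := by ext i j; fin_cases i <;> fin_cases j <;> simp [pPlus]
  map_smul' c b := by ext i j; fin_cases i <;> fin_cases j <;> simp [pPlus]

/-- Unfolding `pPlusₗ`. [folklore] -/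
@[simp] theorem pPlusₗ_apply (b : Fin 2 → ℂ) : pPlusₗ b = pPlus b := rfl

/-- `b ↦ X_b⁻` is CONJUGATE-linear. [folklore] -/
def pMinusₛₗ : (Fin 2 → ℂ) →ₗ⋆[ℂ] Matrix (Fin 3) (Fin 3) ℂ where
  toFun := pMinus
  map_add' b b' := by ext i j; fin_cases i <;> fin_cases j <;> simp [pMinus]
  map_smul' c b := by ext i j; fin_cases i <;> fin_cases j <;> simp [pMinus]

/-- Unfolding `pMinusₛₗ`. [folklore] -/
@[simp] theorem pMinusₛₗ_apply (b : Fin 2 → ℂ) : pMinusₛₗ b = pMinus b := rfl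

/-- `X⁺_{c b} = c · X⁺_b`. [folklore] -/
theorem pPlus_smul (c : ℂ) (b : Fin 2 → ℂ) : pPlus (c • b) = c • pPlus b := pPlusₗ.map_smul c b

/-- `X⁻_{c b} = c̄ · X⁻_b`. [folklore] -/
theorem pMinus_smul (c : ℂ) (b : Fin 2 → ℂ) : pMinus (c • b) = conj c • pMinus b :=
  pMinusₛₗ.map_smulₛₗ c b

/-- The Cauchy–Riemann test vector: `X_{ib} = i·X_b⁺ − i·X_b⁻` in `𝔤_ℂ`. [folklore] -/
theorem pMat_I_smul (b : Fin 2 → ℂ) :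
    pMat (Complex.I • b) = Complex.I • pPlus b - Complex.I • pMinus b := by
  rw [pMat_eq_pPlus_add_pMinus, pPlus_smul, pMinus_smul, Complex.conj_I, neg_smul, sub_eq_add_neg]

/-- `𝔭₊ · 𝔭₊ = 0` (so `𝔭₊`, `𝔭₋` are abelian, square-zero). [folklore] -/
theorem pPlus_mul_pPlus (b b' : Fin 2 → ℂ) : pPlus b * pPlus b' = 0 := by
  ext i j; fin_cases i <;> fin_cases j <;> simp [pPlus, Matrix.mul_apply, Fin.sum_univ_three]

/-- `𝔭₋ · 𝔭₋ = 0`. [folklore] -/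
theorem pMinus_mul_pMinus (b b' : Fin 2 → ℂ) : pMinus b * pMinus b' = 0 := by
  ext i j; fin_cases i <;> fin_cases j <;> simp [pMinus, Matrix.mul_apply, Fin.sum_univ_three]

/-- **ORIENTATION PIN.**  For a `ℂ`-linear `φ` on `𝔤_ℂ = M₃(ℂ)`, the real-linear `b ↦ φ (X_b)` is `ℂ`-linear
(autform-2's Cauchy–Riemann condition `X_{ib} f = i · X_b f` for the complexified differential `φ`) iff `φ` kills
`𝔭₋ = range pMinus` (the LOWER-LEFT block). [folklore] -/
theorem isLinear_comp_pMat_iff {E : Type*} [AddCommGroup E] [Module ℂ E]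
    (φ : Matrix (Fin 3) (Fin 3) ℂ →ₗ[ℂ] E) :
    (∀ b : Fin 2 → ℂ, φ (pMat (Complex.I • b)) = Complex.I • φ (pMat b)) ↔
      ∀ b : Fin 2 → ℂ, φ (pMinus b) = 0 := by
  constructor
  · intro h b
    have hb := h b
    rw [pMat_I_smul, map_sub, map_smul, map_smul, pMat_eq_pPlus_add_pMinus, map_add, smul_add,
      sub_eq_add_neg, add_right_inj, neg_eq_iff_add_eq_zero, ← two_smul ℂ, smul_eq_zero] at hb
    rcases hb with h2 | h0
    · exact absurd h2 two_ne_zero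
    · exact (smul_eq_zero_iff_right Complex.I_ne_zero).1 h0
  · intro h b
    rw [pMat_I_smul, map_sub, map_smul, map_smul, h, smul_zero, sub_zero, pMat_eq_pPlus_add_pMinus, map_add, h,
      add_zero]

/-- Equivalently: `b ↦ φ (X_b)` IS the `ℂ`-linear map `φ ∘ pPlusₗ` iff `φ` kills `𝔭₋`. [folklore] -/
theorem comp_pMat_eq_comp_pPlus_iff {E : Type*} [AddCommGroup E] [Module ℂ E]
    (φ : Matrix (Fin 3) (Fin 3) ℂ →ₗ[ℂ] E) :
    (∀ b : Fin 2 → ℂ, φ (pMat b) = φ (pPlus b)) ↔ ∀ b : Fin 2 → ℂ, φ (pMinus b) = 0 := by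
  refine ⟨fun h b => ?_, fun h b => by rw [pMat_eq_pPlus_add_pMinus, map_add, h, add_zero]⟩
  have := h b
  rwa [pMat_eq_pPlus_add_pMinus, map_add, add_eq_left] at this

end BallForms

end Literature.AlgebraicGeometry.ShimuraVarieties

end
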